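import Literature.MathematicalPhysics.QuantumFieldTheory.Balaban1983to89.B7Prop9FlatRec
import Literature.MathematicalPhysics.QuantumFieldTheory.Balaban1983to89.B8Lemma1NonAbelianRecLoops
import Literature.MathematicalPhysics.QuantumFieldTheory.Balaban1983to89.B7Prop9General

/-!
# `Balaban1983to89.B7Prop9GeneralRec` — [Balaban1985Averaging] Proposition 9 (p. 49), (197)–(200), AT A GENERAL REGULAR BACKGROUND, FOR THE RECORD's TWISTED SITE AVERAGE (78) over
# CENTRED blocks ([Balaban1987RG1] (0.3)–(0.4)) — the record twin of the engine's `B7Prop9General`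

statement-level skeleton of published theorems with citation tags; proofs where landed; nothing here is a claim about the Yang–Mills mass gap

CITATION HEADER (lean-in-tree rule).  Cell `pub-ymgap`, seat `pub-ymgap-dag-n05-e` g36 (N05-REC LEAD PEN); item R1 ([3] layer), Sect. G block, file 2: the record twin of `B7Prop9General`
(lit-balaban p28).  `--kind proof --supports stmt-QuantumFields-20541` (K0⁷; count-neutral; no definition).  Sources READ: [3] = [Balaban1985Averaging] pp. 45–49 (176)–(200), p. 27
(display after (59)), p. 30 (78), pp. 24–25 (axial gauge) (`paper:balaban1985-cmp98-averaging`); [I] = [Balaban1987RG1] (0.3)–(0.4) pp. 252–253.  REUSED BY NAME: the engine's localisation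
device `B7Prop9General.{clamp, rotClamp, rotClamp_mul, siteBd_rotClamp, bondBd_rotClamp, norm_Rc_sub_self_le, prod_block_lt_one, norm_hol_sub_one_le_of_l1, norm_Rc_expUnit_sub_self_le, CovBondBd}`
(generic in the box), `B7Prop1Explicit.{axialFn, axial_bond_bound, hol_gaugeAct, mlog_units_conj}`, `B7Eq99Concrete.R0fun`, the record's `B7SectCDGaugeAveragesRec.{SexpZ, savgZ, R0avgZ}`,
`B7SectEFLinearisationRec.{CovBlockBdZ, vtilGZ}`, `BlockAveragingZd.{offZ, XZ, WZ, bavgZ}`, `B8Lemma1NonAbelianRecLoops.{halfVec, pairLo, pairHi, norm_XZ_le, omegaC}`, and this seat's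
`B7Prop9FlatRec.{core200Z, core199Z}`.

WHAT IS PROVED (sorry-free; `L = 2s + 1`).  §1 the centred boxes `[q − s𝟙, q + s𝟙]` ∕ `[q − s𝟙, q + Le_μ + s𝟙]` and the engine's clamp on them; §2 `rotClamp_axial_blockZ`, `R0avgZ_eq_savgZ_rotClamp` ((78) reads
only the block), `savgZ_Rc` ((78) is covariant under a constant unit-ball rotation); §3 ★`eq200Z_general` ((198)∕(200) for the record: `‖ṽ′(y) − 1‖ ≤ α₄ + C′₅L(α′₄ + 4dLα₀α₄)`); §4
`crossing_boundZ` (the crossing loops of the two centred blocks, `≤ 4(d+1)²L²α₀`), `gauge2Z_bond_bound` (the two-block gauge: axial at `c₋` on `{x_μ ≤ q_μ + s}`, `V₀(c)`·axial at `c₊` beyond);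
the sequel `B7Eq199GeneralRec` carries §5–§6: `eq199Z_general_seg`, `eq199Z_general`, `prop9_generalZ` (Proposition 9 for the record, packaged as (180b)∕(180a) one scale up).
HONEST SCOPE.  Port of the engine's Prop. 9 to the record's objects (same constants, same honest weakenings as the engine's READINGS); Prop. 10 for the record is the sequel; nothing of [3]∕[I]
asserted beyond what is proved; `HThm4Rec` UNDISCHARGED; N05 discharged of record untouched; N07 not claimable; counts unmoved (typed 28∕28 · discharged 8∕28); one finite 𝕋⁴ programme at fixed
ε — nothing continuum ∕ ℝ⁴ ∕ OS ∕ mass gap ∕ Clay.  No `def`, no `instance`, no `notation`, no `sorry`.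
-/

set_option autoImplicit false

noncomputable section

open NormedSpace Finset Metric

namespace Literature.MathematicalPhysics.QuantumFieldTheory.Balaban1983to89.B7Prop9GeneralRec

open B7Prop1Explicit hiding Site
open B7Prop1Explicit renaming Site → SiteZ
open MatrixLog B7Eq92Concrete B7Eq170Flat
open B7Eq99Concrete (R0fun R0fun_apply R0fun_self R0fun_add)
open B7Prop6Flat (norm_units_inv_sub_one_le)
open B7Prop9Flat (SiteBd BondBd setup arith199 arith200 C4' C5')
open B7Prop9General (clamp clampZ rotClamp rotClamp_mul siteBd_rotClamp bondBd_rotClamp prod_block_lt_one norm_hol_sub_one_le_of_l1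
  norm_Rc_expUnit_sub_self_le CovBondBd)
open BlockAveragingZd (IdxZ offZ XZ WZ bavgZ bavgZ_apply natAbs_offZ_le)
open B8Lemma1NonAbelian (zsmul_e_apply)
open B8Lemma1NonAbelianRecLoops (halfVec pairLo pairHi mem_pairBox_iff norm_XZ_le omegaC)
open B7Prop3FlatRecSide (l1_offZ_le_dL)
open B7SectCDGaugeAveragesRec (SexpZ savgZ R0avgZ)
open B7SectEFLinearisationRec (CovBlockBdZ vtilGZ)
open B7Prop9FlatRec (savgZ_apply SexpZ_eq_bmean core200Z core199Z)

variable {d : ℕ}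

/-! ## §1 The centred boxes and the engine's clamp on them -/

section Boxes

variable {L s : ℕ}

/-- The engine's clamp fixes the points of its box. [cite: Balaban1985Averaging, p.27 (display after (59)) (bookkeeping)] -/
theorem clamp_of_mem {lo up x : SiteZ d} (h : ∀ i : Fin d, lo i ≤ x i ∧ x i ≤ up i) : clamp lo up x = x := by
  funext i
  have := h i
  simp only [clamp, clampZ, max_def, min_def]
  split_ifs <;> omega

/-- The centred block `B(q) = [q − s𝟙, q + s𝟙]` is a nonempty box. [cite: Balaban1987RG1, (0.3) p.252] -/
theorem boxZ_le (L : ℕ) (q : SiteZ d) : ∀ i : Fin d, (q - (halfVec L : SiteZ d)) i ≤ (q + (halfVec L : SiteZ d)) i := fun i => by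
  simp only [Pi.sub_apply, Pi.add_apply, halfVec]; omega

/-- The centre lies in its centred block. [cite: Balaban1987RG1, (0.3) p.252] -/
theorem ctr_mem_boxZ (L : ℕ) (q : SiteZ d) : ∀ i : Fin d, (q - (halfVec L : SiteZ d)) i ≤ q i ∧ q i ≤ (q + (halfVec L : SiteZ d)) i := fun i => by
  simp only [Pi.sub_apply, Pi.add_apply, halfVec]; constructor <;> omega

/-- The block points `q + offZ L r` lie in the centred block (`L = 2s + 1`). [cite: Balaban1987RG1, (0.3) p.252] -/
theorem off_mem_boxZ (hLs : L = 2 * s + 1) (q : SiteZ d) (r : Fin d → Fin L) :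
    ∀ i : Fin d, (q - (halfVec L : SiteZ d)) i ≤ (q + offZ L r) i ∧ (q + offZ L r) i ≤ (q + (halfVec L : SiteZ d)) i := fun i => by
  have hs2 : (L - 1) / 2 = s := by omega
  have := natAbs_offZ_le hLs r i
  simp only [Pi.sub_apply, Pi.add_apply, halfVec, hs2]; constructor <;> omega

/-- A point of the centred block is within `ℓ¹`-distance `d·s ≤ dL` of the centre. [cite: Balaban1987RG1, (0.3) p.252] -/
theorem l1_le_of_mem_boxZ (hLs : L = 2 * s + 1) {q p : SiteZ d} (h : ∀ i : Fin d, (q - (halfVec L : SiteZ d)) i ≤ p i ∧ p i ≤ (q + (halfVec L : SiteZ d)) i) :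
    (l1 (p - q) : ℝ) ≤ d * L := by
  have hs2 : (L - 1) / 2 = s := by omega
  have h1 : l1 (p - q) ≤ d * s := by
    unfold l1
    calc ∑ κ, ((p - q) κ).natAbs ≤ ∑ _κ : Fin d, s := Finset.sum_le_sum fun κ _ => by
            have := h κ; simp only [Pi.sub_apply, Pi.add_apply, halfVec, hs2] at this ⊢; omega
      _ = d * s := by simp
  have h2 : (l1 (p - q) : ℝ) ≤ d * s := by exact_mod_cast h1
  have h3 : (s : ℝ) ≤ L := by exact_mod_cast (show s ≤ L by omega)
  exact h2.trans (mul_le_mul_of_nonneg_left h3 (Nat.cast_nonneg d))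

/-- The two-block box `[q − s𝟙, q + Le_μ + s𝟙]` (`pairLo`∕`pairHi`) is nonempty. [cite: Balaban1985RegularSpaces, (1.23) p.79] -/
theorem pairBox_le (L : ℕ) (q : SiteZ d) (μ : Fin d) : ∀ i : Fin d, pairLo L q i ≤ pairHi L q μ i := fun i => by
  simp only [pairLo, pairHi, halfVec, Pi.sub_apply, Pi.add_apply, zsmul_e_apply]; split_ifs <;> omega

/-- Membership in the two-block box, in the engine's `∀ i` form. [cite: Balaban1985RegularSpaces, (1.23) p.79 (bookkeeping)] -/
theorem mem_pairBox_iff' (hLs : L = 2 * s + 1) (q : SiteZ d) (μ : Fin d) (x : SiteZ d) :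
    (∀ i : Fin d, pairLo L q i ≤ x i ∧ x i ≤ pairHi L q μ i) ↔ ∀ i : Fin d, -(s : ℤ) ≤ x i - q i ∧ x i - q i ≤ (if i = μ then (L : ℤ) else 0) + s := by
  rw [← mem_pairBox_iff hLs q μ x]
  exact ⟨fun h => ⟨fun i => (h i).1, fun i => (h i).2⟩, fun h i => ⟨h.1 i, h.2 i⟩⟩

/-- The six kinds of points used below lie in the two-block box: `q`, `q + offZ L r`, `q′ = q + Le_μ`, `q′ + offZ L r`. [cite: Balaban1985RegularSpaces, (1.23) p.79 (bookkeeping)] -/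
theorem mem_pairBox_points (hLs : L = 2 * s + 1) (q : SiteZ d) (μ : Fin d) (r : Fin d → Fin L) :
    (∀ i : Fin d, pairLo L q i ≤ q i ∧ q i ≤ pairHi L q μ i) ∧
    (∀ i : Fin d, pairLo L q i ≤ (q + offZ L r) i ∧ (q + offZ L r) i ≤ pairHi L q μ i) ∧
    (∀ i : Fin d, pairLo L q i ≤ (q + (L : ℤ) • e μ) i ∧ (q + (L : ℤ) • e μ) i ≤ pairHi L q μ i) ∧
    (∀ i : Fin d, pairLo L q i ≤ (q + (L : ℤ) • e μ + offZ L r) i ∧ (q + (L : ℤ) • e μ + offZ L r) i ≤ pairHi L q μ i) := by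
  have hn : ∀ i : Fin d, -(s : ℤ) ≤ offZ L r i ∧ offZ L r i ≤ s := fun i => by
    have := natAbs_offZ_le hLs r i; omega
  refine ⟨?_, ?_, ?_, ?_⟩ <;> rw [mem_pairBox_iff' hLs] <;> intro i <;> have := hn i <;>
    simp only [Pi.add_apply, zsmul_e_apply, sub_self, add_sub_cancel_left] <;> constructor <;> (try split_ifs) <;> omega

/-- A point of the two-block box is within `ℓ¹`-distance `d·s + L + s ≤ 2dL + L`… we record the cruder `≤ 2dL + L`. [cite: Balaban1985RegularSpaces, (1.23) p.79 (bookkeeping)] -/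
theorem l1_le_of_mem_pairBox (hLs : L = 2 * s + 1) (hd : 1 ≤ d) {q p : SiteZ d} {μ : Fin d}
    (h : ∀ i : Fin d, pairLo L q i ≤ p i ∧ p i ≤ pairHi L q μ i) : (l1 (p - q) : ℝ) ≤ 2 * d * L := by
  have h' := (mem_pairBox_iff' hLs q μ p).1 h
  have h1 : l1 (p - q) ≤ d * s + (L + s) := by
    unfold l1
    have hterm : ∀ κ, ((p - q) κ).natAbs ≤ s + (if κ = μ then L + s else 0) := fun κ => by
      have := h' κ; simp only [Pi.sub_apply]; split_ifs at this ⊢ <;> omega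
    calc ∑ κ, ((p - q) κ).natAbs ≤ ∑ κ : Fin d, (s + (if κ = μ then L + s else 0)) := Finset.sum_le_sum fun κ _ => hterm κ
      _ = d * s + (L + s) := by
          rw [Finset.sum_add_distrib, Finset.sum_const, Finset.card_univ, Fintype.card_fin, smul_eq_mul, Finset.sum_ite_eq']
          simp
  have h2 : (l1 (p - q) : ℝ) ≤ d * s + (L + s) := by exact_mod_cast h1
  have h3 : (s : ℝ) ≤ L := by exact_mod_cast (show s ≤ L by omega)
  have h4 : 2 * (s : ℝ) + 1 = L := by
    have : ((2 * s + 1 : ℕ) : ℝ) = L := by rw [hLs]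
    push_cast at this; linarith
  have hd' : (1 : ℝ) ≤ d := by exact_mod_cast hd
  nlinarith

end Boxes

/-! ## §2 The twisted average (78) for the record reads only the centred block; covariance under constant rotations -/

section Rot

variable {𝔸 : Type*} [NormedRing 𝔸] [NormOneClass 𝔸] [NormedAlgebra ℂ 𝔸] [CompleteSpace 𝔸]
variable {L s : ℕ}

omit [NormOneClass 𝔸] in
/-- Congruence of the record's site average (78) on the block data. [cite: Balaban1985Averaging, (78) p.30; Balaban1987RG1, (0.3) p.252] -/
theorem savgZ_congr {g g' : SiteZ d → 𝔸ˣ} {y : SiteZ d} (h0 : g y = g' y) (h : ∀ r : Fin d → Fin L, g (y + offZ L r) = g' (y + offZ L r)) :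
    savgZ L g y = savgZ L g' y := by
  have hS : SexpZ L g y = SexpZ L g' y := by
    unfold SexpZ
    exact Finset.sum_congr rfl fun r _ => by rw [h0, h r]
  rw [savgZ_apply, savgZ_apply, h0, hS]

omit [NormOneClass 𝔸] [NormedAlgebra ℂ 𝔸] [CompleteSpace 𝔸] in
/-- **The block quantity of (180d) on the rotated data, in the axial gauge at the centre `q`** (record, centred block): `(R(w)v)(q)⁻¹(R(w)v)(q + n) = v(q)⁻¹(R_{0,q}v)(q + n)`,
`w = V₀(Γ_{q,·})`. [cite: Balaban1985Averaging, (180) p.46, p.27 (display after (59)); Balaban1987RG1, (0.3) p.252] -/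
theorem rotClamp_axial_blockZ (hLs : L = 2 * s + 1) (V₀ : SiteZ d → Fin d → 𝔸ˣ) (v : SiteZ d → 𝔸ˣ) (q : SiteZ d) (r : Fin d → Fin L) :
    (rotClamp (axialFn V₀ q) (q - (halfVec L : SiteZ d)) (q + (halfVec L : SiteZ d)) v q)⁻¹ * rotClamp (axialFn V₀ q) (q - (halfVec L : SiteZ d)) (q + (halfVec L : SiteZ d)) v (q + offZ L r)
      = (v q)⁻¹ * R0fun V₀ q v (q + offZ L r) := by
  simp only [rotClamp, clamp_of_mem (ctr_mem_boxZ L q), clamp_of_mem (off_mem_boxZ hLs q r), R0fun_add]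
  simp [axialFn]

omit [NormOneClass 𝔸] in
/-- **(78) for the record reads only the centred block**: the twisted average `(R̄₀v)(q)` (`R0avgZ`) is the flat record average `savgZ` of the clamped rotated function in the axial gauge at `q`.
[cite: Balaban1985Averaging, (78) p.30, p.27 (display after (59)); Balaban1987RG1, (0.3) p.252] -/
theorem R0avgZ_eq_savgZ_rotClamp (hLs : L = 2 * s + 1) (V₀ : SiteZ d → Fin d → 𝔸ˣ) (v : SiteZ d → 𝔸ˣ) (q : SiteZ d) :
    R0avgZ L V₀ v q = savgZ L (rotClamp (axialFn V₀ q) (q - (halfVec L : SiteZ d)) (q + (halfVec L : SiteZ d)) v) q := by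
  unfold R0avgZ
  refine savgZ_congr ?_ fun r => ?_
  · simp only [R0fun_self, rotClamp, clamp_of_mem (ctr_mem_boxZ L q)]
    simp [axialFn]
  · simp only [R0fun_add, rotClamp, clamp_of_mem (off_mem_boxZ hLs q r)]
    simp [axialFn]

/-- **(78) for the record is covariant under a constant rotation** `R(T)`, `T ∈ U1`, when the block quantities lie in the disc of the logarithm (termwise `mlog_units_conj`, (57)).
[cite: Balaban1985Averaging, (57) p.27, (78) p.30, (21)–(23) p.21] -/
theorem savgZ_Rc {T : 𝔸ˣ} (hT : T ∈ U1 𝔸) {g : SiteZ d → 𝔸ˣ} {y : SiteZ d}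
    (hg : ∀ r : Fin d → Fin L, ‖((((g y)⁻¹ * g (y + offZ L r) : 𝔸ˣ)) : 𝔸) - 1‖ < 1) :
    savgZ L (fun x => Rc T (g x)) y = Rc T (savgZ L g y) := by
  have hS : SexpZ L (fun x => Rc T (g x)) y = (T : 𝔸) * SexpZ L g y * ((T⁻¹ : 𝔸ˣ) : 𝔸) := by
    simp only [SexpZ, Finset.mul_sum, Finset.sum_mul]
    refine Finset.sum_congr rfl fun r _ => ?_
    rw [← map_inv, ← map_mul, Rc_apply, Units.val_mul, Units.val_mul, mlog_units_conj hT (hg r), mul_smul_comm,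
      smul_mul_assoc]
  rw [savgZ_apply, savgZ_apply, hS, expUnit_conj, ← map_mul]

omit [NormedAlgebra ℂ 𝔸] [CompleteSpace 𝔸] in
/-- `‖R(u)X − 1‖ ≤ ‖X − 1‖` for `u ∈ U1`. [cite: Balaban1985Averaging, (57) p.27 (bookkeeping)] -/
theorem norm_Rc_sub_one_le {u : 𝔸ˣ} (hu : u ∈ U1 𝔸) (X : 𝔸ˣ) :
    ‖((Rc u X : 𝔸ˣ) : 𝔸) - 1‖ ≤ ‖(X : 𝔸) - 1‖ := by
  rw [Rc_apply, Units.val_mul, Units.val_mul]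
  exact norm_units_conj_sub_one_le hu _

end Rot

/-! ## §3 (198)/(200) at a general background, for the record -/

section Eq200

variable {𝔸 : Type*} [NormedRing 𝔸] [NormOneClass 𝔸] [NormedAlgebra ℂ 𝔸] [CompleteSpace 𝔸]
variable {L s : ℕ}

/-- ★ **(198)/(200) AT A GENERAL BACKGROUND `V₀`, FOR THE RECORD** — the engine's `eq200_general` with the centred block: under (180a)–(180d) (the block condition `CovBlockBdZ` on centred blocks),
`50Lα′₃ ≤ 1` and `10³(d+1)L·(α′₄ + 4dLα₀α₄) ≤ 1`, at every block centre `y = Lz`: `‖(R̄₀(v′v₁))(y)·((R̄₀v₁)(y))⁻¹ − 1‖ ≤ α₄ + C′₅L·(α′₄ + 4dLα₀α₄)` (reduction to `core200Z` in the axial gauge at `y`).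
[cite: Balaban1985Averaging, Proposition 9 (200) p.49, (198) p.49, (180)–(184) p.46, (78) p.30; Balaban1987RG1, (0.3) p.252] -/
theorem eq200Z_general (hLs : L = 2 * s + 1) {V₀ : SiteZ d → Fin d → 𝔸ˣ} (hV : ∀ x κ, V₀ x κ ∈ U1 𝔸)
    {α₀ : ℝ} (hα₀ : 0 ≤ α₀)
    (h44 : ∀ (x : SiteZ d) (κ μ : Fin d), κ ≠ μ → ‖((hol V₀ x (plaqWord κ μ) : 𝔸ˣ) : 𝔸) - 1‖ ≤ α₀)
    {v' v₁ : SiteZ d → 𝔸ˣ} {α₃ α₃' α₄ α₄' : ℝ}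
    (h4a : SiteBd v' α₄) (h4b : CovBondBd V₀ v' α₄') (h3c : SiteBd v₁ α₃) (h3d : CovBlockBdZ L V₀ v₁ (L * α₃'))
    (hα₄ : α₄ ≤ 1 / 2) (hα₄' : 0 ≤ α₄') (hα₃ : α₃ ≤ 1 / 5) (hα₃' : 50 * (L * α₃') ≤ 1)
    (hs : 1000 * ((d : ℝ) + 1) * L * (α₄' + 4 * (d * L * α₀) * α₄) ≤ 1) (z : SiteZ d) :
    ‖(((R0avgZ L V₀ (v' * v₁) ((L : ℤ) • z) * (R0avgZ L V₀ v₁ ((L : ℤ) • z))⁻¹ : 𝔸ˣ)) : 𝔸) - 1‖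
      ≤ α₄ + C5' d * L * (α₄' + 4 * (d * L * α₀) * α₄) := by
  have hL : 1 ≤ L := by omega
  set q : SiteZ d := (L : ℤ) • z with hq
  set w : SiteZ d → 𝔸ˣ := axialFn V₀ q with hwdef
  set W' : SiteZ d → 𝔸ˣ := rotClamp w (q - (halfVec L : SiteZ d)) (q + (halfVec L : SiteZ d)) v' with hW'
  set W₁ : SiteZ d → 𝔸ˣ := rotClamp w (q - (halfVec L : SiteZ d)) (q + (halfVec L : SiteZ d)) v₁ with hW₁
  set a' : ℝ := α₄' + 4 * (d * L * α₀) * α₄ with ha'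
  have hα₄0 : 0 ≤ α₄ := (norm_nonneg _).trans (h4a 0)
  have hw : ∀ x, w x ∈ U1 𝔸 := fun x => axialFn_mem hV q x
  have hbox := boxZ_le L q
  have hG : ∀ (p : SiteZ d) (κ : Fin d), (∀ i : Fin d, (q - (halfVec L : SiteZ d)) i ≤ p i ∧ p i ≤ (q + (halfVec L : SiteZ d)) i) →
      (∀ i : Fin d, (q - (halfVec L : SiteZ d)) i ≤ (p + e κ) i ∧ (p + e κ) i ≤ (q + (halfVec L : SiteZ d)) i) →
      ‖((gaugeAct w V₀ p κ : 𝔸ˣ) : 𝔸) - 1‖ ≤ d * L * α₀ := by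
    intro p κ hp _
    refine (axial_bond_bound V₀ hV q h44 hα₀ p κ).trans ?_
    exact mul_le_mul_of_nonneg_right (l1_le_of_mem_boxZ hLs hp) hα₀
  have hg0 : 0 ≤ (d : ℝ) * L * α₀ := by positivity
  have h4bW : BondBd W' a' := bondBd_rotClamp hbox hw hV hg0 hG h4a hα₄ h4b hα₄'
  have h4aW : SiteBd W' α₄ := siteBd_rotClamp hw _ _ h4a
  have h3cW : SiteBd W₁ α₃ := siteBd_rotClamp hw _ _ h3c
  have ha'0 : 0 ≤ a' := by rw [ha']; positivity
  obtain ⟨hVA, h4, ha0, ha2, hθ0, hθ1, hθ2⟩ := setup hL h4bW ha'0 hs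
  have hL' : (1 : ℝ) ≤ L := by exact_mod_cast hL
  have hK : (1 : ℝ) ≤ (d : ℝ) + 1 := by have := Nat.cast_nonneg (α := ℝ) d; linarith
  have hw' : ∀ x, ‖((W₁ x : 𝔸ˣ) : 𝔸) - 1‖ ≤ 2 / 5 := fun x => (h3cW x).trans (by linarith)
  have hwi : ∀ x, ‖((((W₁ x)⁻¹ : 𝔸ˣ)) : 𝔸) - 1‖ ≤ 2 / 5 := fun x =>
    (norm_units_inv_sub_one_le (W₁ x) ((h3cW x).trans (by linarith))).trans (by linarith [h3cW x])
  have hq1 : (L : ℝ) * α₃' ≤ 1 / 50 := by linarith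
  have hqb : ∀ r : Fin d → Fin L, ‖((((W₁ q)⁻¹ * W₁ (q + offZ L r) : 𝔸ˣ)) : 𝔸) - 1‖ ≤ L * α₃' := by
    intro r
    rw [hW₁, hwdef, rotClamp_axial_blockZ hLs]
    exact h3d z r
  have hid : R0avgZ L V₀ (v' * v₁) q * (R0avgZ L V₀ v₁ q)⁻¹ = savgZ L (W' * W₁) q * (savgZ L W₁ q)⁻¹ := by
    rw [R0avgZ_eq_savgZ_rotClamp hLs, R0avgZ_eq_savgZ_rotClamp hLs, rotClamp_mul]
  have key := core200Z hL ha0 hVA hθ0 hθ1 le_rfl hwi hw' hq1 (by linarith) q hqb (h4aW q)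
  rw [hid]
  have h2 := arith200 hK hL' ha'0 h4 hq1
  calc _ ≤ _ := key
    _ ≤ α₄ + 64 * ((d : ℝ) + 1) * L * a' := by linarith
    _ = _ := by rw [C5']

end Eq200

/-! ## §4 The crossing bonds of the two centred blocks and the two-block gauge -/

section Crossing

variable {𝔸 : Type*} [NormedRing 𝔸] [NormOneClass 𝔸] [NormedAlgebra ℂ 𝔸] [CompleteSpace 𝔸]
variable {L s : ℕ}

omit [NormedAlgebra ℂ 𝔸] [CompleteSpace 𝔸] in
/-- **The crossing bond `b = ⟨p, p + e_μ⟩` between the centred blocks `B(q)` and `B(q′)`, `q′ = q + Le_μ`** (`p ∈ B(q)`, `p + e_μ ∈ B(q′)`): the mismatch `V₀(Γ_{q,p})·V₀(b)·(V₀(c)V₀(Γ_{q′,p+e_μ}))⁻¹`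
of the two transports (the loop `Γ_{q,p} ∪ b ∪ Γ_{q′,p+e_μ}⁻¹ ∪ (−c)`, print's loops of (193)–(195)) deviates from `1` by `≤ 4(d+1)²L²α₀`.  PROOF in the axial gauge at `q`: the mismatch is
`V^{ax}(b)·(V^{ax}(c ∪ Γ_{q′,p+e_μ}))⁻¹`, a bond at `ℓ¹`-distance `≤ dL` and a word of `≤ (d+1)L` bonds from `q` (`norm_hol_sub_one_le_of_l1` with `axial_bond_bound`).
[cite: Balaban1985Averaging, (193)–(195) p.48, pp.24–25; Balaban1987RG1, (0.3) p.252] -/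
theorem crossing_boundZ {V₀ : SiteZ d → Fin d → 𝔸ˣ} (hV : ∀ x κ, V₀ x κ ∈ U1 𝔸) {α₀ : ℝ} (hα₀ : 0 ≤ α₀)
    (h44 : ∀ (x : SiteZ d) (κ μ : Fin d), κ ≠ μ → ‖((hol V₀ x (plaqWord κ μ) : 𝔸ˣ) : 𝔸) - 1‖ ≤ α₀)
    (q : SiteZ d) (μ : Fin d) (p : SiteZ d) (hl1 : (l1 (p - q) : ℝ) ≤ d * L)
    (hl1' : (l1 (p + e μ - (q + (L : ℤ) • e μ)) : ℝ) ≤ d * L) :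
    ‖((axialFn V₀ q p * V₀ p μ *
        (hol V₀ q (seg μ L) * axialFn V₀ (q + (L : ℤ) • e μ) (p + e μ))⁻¹ : 𝔸ˣ) : 𝔸) - 1‖
      ≤ 4 * ((d : ℝ) + 1) ^ 2 * L ^ 2 * α₀ := by
  set w : SiteZ d → 𝔸ˣ := axialFn V₀ q with hw
  set q' : SiteZ d := q + (L : ℤ) • e μ with hq'
  set Vax : SiteZ d → Fin d → 𝔸ˣ := gaugeAct w V₀ with hVax
  have hVaxU : ∀ x κ, Vax x κ ∈ U1 𝔸 := gaugeAct_mem hV (axialFn_mem hV q)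
  have hbd : ∀ (y : SiteZ d) (κ : Fin d), ‖((Vax y κ : 𝔸ˣ) : 𝔸) - 1‖ ≤ l1 (y - q) * α₀ :=
    fun y κ => axial_bond_bound V₀ hV q h44 hα₀ y κ
  set ω₂ : List (Letter d) := seg μ (L : ℤ) ++ treeWord (p + e μ - q') with hω₂
  have hdisp : q + disp ω₂ = p + e μ := by
    rw [hω₂, disp_append, disp_seg, disp_treeWord, hq']; abel
  have hS : hol V₀ q (seg μ L) * axialFn V₀ q' (p + e μ) = hol V₀ q ω₂ := by
    rw [hω₂, hol_append, disp_seg, axialFn]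
  have hwq : w q = 1 := by simp [hw, axialFn]
  have hhol : hol V₀ q ω₂ = hol Vax q ω₂ * w (p + e μ) := by
    have h1 := hol_gaugeAct w V₀ q ω₂
    rw [← hVax, hdisp, hwq, one_mul] at h1
    rw [h1, inv_mul_cancel_right]
  have hG : w p * V₀ p μ * (hol V₀ q (seg μ L) * axialFn V₀ q' (p + e μ))⁻¹ = Vax p μ * (hol Vax q ω₂)⁻¹ := by
    rw [hS, hhol, show Vax p μ = w p * V₀ p μ * (w (p + e μ))⁻¹ from rfl]
    group
  have hd : (0 : ℝ) ≤ d := Nat.cast_nonneg d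
  have hL0 : (0 : ℝ) ≤ L := Nat.cast_nonneg L
  have hT1 : ‖((Vax p μ : 𝔸ˣ) : 𝔸) - 1‖ ≤ d * L * α₀ := (hbd p μ).trans (mul_le_mul_of_nonneg_right hl1 hα₀)
  have hlen : (ω₂.length : ℝ) ≤ ((d : ℝ) + 1) * L := by
    rw [hω₂, List.length_append, B7Prop9Flat.length_seg_nat, length_treeWord, Nat.cast_add]
    linarith
  have hT2 : ‖((hol Vax q ω₂ : 𝔸ˣ) : 𝔸) - 1‖ ≤ ((d : ℝ) + 1) ^ 2 * L ^ 2 * α₀ := by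
    have h1 := norm_hol_sub_one_le_of_l1 hVaxU q hα₀ hbd ω₂ q
    rw [sub_self, show l1 (0 : SiteZ d) = 0 by simp [l1], Nat.cast_zero, zero_add] at h1
    refine h1.trans ?_
    have hl0 : (0 : ℝ) ≤ ω₂.length := Nat.cast_nonneg _
    have := mul_le_mul hlen hlen hl0 (by positivity)
    calc (ω₂.length : ℝ) * ω₂.length * α₀ ≤ (((d : ℝ) + 1) * L) * (((d : ℝ) + 1) * L) * α₀ := mul_le_mul_of_nonneg_right this hα₀
      _ = _ := by ring
  have hU2 : hol Vax q ω₂ ∈ U1 𝔸 := hol_mem hVaxU _ _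
  rw [hG, Units.val_mul]
  calc _ ≤ ‖((Vax p μ : 𝔸ˣ) : 𝔸) - 1‖ + ‖(((hol Vax q ω₂)⁻¹ : 𝔸ˣ) : 𝔸) - 1‖ :=
        B8Ineq170.norm_mul_sub_one_le_of_norm_le_one (mem_U1.mp (hVaxU p μ)).1
    _ ≤ d * L * α₀ + ((d : ℝ) + 1) ^ 2 * L ^ 2 * α₀ := add_le_add hT1 ((norm_inv_sub_one_le hU2).trans hT2)
    _ ≤ 4 * ((d : ℝ) + 1) ^ 2 * L ^ 2 * α₀ := by
        have hL2 : (L : ℝ) ≤ (L : ℝ) ^ 2 := by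
          rcases Nat.eq_zero_or_pos L with h | h
          · simp [h]
          · have : (1 : ℝ) ≤ L := by exact_mod_cast h
            nlinarith
        have h3 : (d : ℝ) * L * α₀ ≤ ((d : ℝ) + 1) ^ 2 * L ^ 2 * α₀ := by
          have := mul_le_mul (show (d : ℝ) ≤ ((d : ℝ) + 1) ^ 2 by nlinarith) hL2 hL0 (by positivity)
          exact mul_le_mul_of_nonneg_right this hα₀
        nlinarith [h3, show 0 ≤ ((d : ℝ) + 1) ^ 2 * L ^ 2 * α₀ by positivity]

omit [NormOneClass 𝔸] [NormedAlgebra ℂ 𝔸] [CompleteSpace 𝔸] in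
/-- `ℓ¹` bookkeeping of the crossing bond: for `p` on the far face of `B(q)` (`p_μ = q_μ + s`) inside the two-block box, both `p − q` and `p + e_μ − q′` have `|·|₁ ≤ d·s ≤ dL`.
[cite: Balaban1987RG1, (0.3) p.252 (bookkeeping)] -/
theorem l1_crossing (hLs : L = 2 * s + 1) {q p : SiteZ d} {μ : Fin d}
    (h : ∀ i : Fin d, pairLo L q i ≤ p i ∧ p i ≤ pairHi L q μ i) (hpμ : p μ = q μ + s) :
    (l1 (p - q) : ℝ) ≤ d * L ∧ (l1 (p + e μ - (q + (L : ℤ) • e μ)) : ℝ) ≤ d * L := by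
  have h' := (mem_pairBox_iff' hLs q μ p).1 h
  have hsL : (s : ℝ) ≤ L := by exact_mod_cast (show s ≤ L by omega)
  have hdsL : (d : ℝ) * s ≤ d * L := mul_le_mul_of_nonneg_left hsL (Nat.cast_nonneg d)
  have hterm1 : ∀ κ, ((p - q) κ).natAbs ≤ s := fun κ => by
    have := h' κ
    by_cases hκ : κ = μ
    · subst hκ; simp only [Pi.sub_apply]; omega
    · simp only [hκ, if_false] at this; simp only [Pi.sub_apply]; omega
  have hterm2 : ∀ κ, ((p + e μ - (q + (L : ℤ) • e μ)) κ).natAbs ≤ s := fun κ => by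
    have := h' κ
    by_cases hκ : κ = μ
    · subst hκ; simp only [Pi.sub_apply, Pi.add_apply, B8Lemma1NonAbelian.e_apply_self, zsmul_e_apply, if_true]; omega
    · simp only [hκ, if_false] at this
      simp only [Pi.sub_apply, Pi.add_apply, zsmul_e_apply, e_apply, hκ, if_false]
      omega
  have h1 : l1 (p - q) ≤ d * s := by
    unfold l1
    calc ∑ κ, ((p - q) κ).natAbs ≤ ∑ _κ : Fin d, s := Finset.sum_le_sum fun κ _ => hterm1 κ
      _ = d * s := by simp
  have h2 : l1 (p + e μ - (q + (L : ℤ) • e μ)) ≤ d * s := by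
    unfold l1
    calc ∑ κ, ((p + e μ - (q + (L : ℤ) • e μ)) κ).natAbs ≤ ∑ _κ : Fin d, s := Finset.sum_le_sum fun κ _ => hterm2 κ
      _ = d * s := by simp
  exact ⟨le_trans (by exact_mod_cast h1) hdsL, le_trans (by exact_mod_cast h2) hdsL⟩

omit [NormedAlgebra ℂ 𝔸] [CompleteSpace 𝔸] in
/-- **The bonds of the two-block box in the two-block gauge deviate from `1` by `≤ 4(d+1)²L²α₀`** — the gauge `ŵ` is axial at `q` on `{x_μ ≤ q_μ + s}` (the `B(q)` side) and `V₀(c)`·axial at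
`q′ = q + Le_μ` beyond (the `B(q′)` side): inside each side the thin loops of `axial_bond_bound` (`≤ (2d+1)Lα₀`), across the face the crossing loops of `crossing_boundZ`.
[cite: Balaban1985Averaging, (186)–(187) pp.46–47, (193)–(195) p.48, pp.24–25; Balaban1987RG1, (0.3) p.252] -/
theorem gauge2Z_bond_bound (hLs : L = 2 * s + 1) (hd : 1 ≤ d) {V₀ : SiteZ d → Fin d → 𝔸ˣ} (hV : ∀ x κ, V₀ x κ ∈ U1 𝔸)
    {α₀ : ℝ} (hα₀ : 0 ≤ α₀)
    (h44 : ∀ (x : SiteZ d) (κ μ : Fin d), κ ≠ μ → ‖((hol V₀ x (plaqWord κ μ) : 𝔸ˣ) : 𝔸) - 1‖ ≤ α₀)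
    (q : SiteZ d) (μ : Fin d) {ŵ : SiteZ d → 𝔸ˣ}
    (hŵ : ∀ x, ŵ x = if x μ ≤ q μ + s then axialFn V₀ q x else hol V₀ q (seg μ L) * axialFn V₀ (q + (L : ℤ) • e μ) x)
    {p : SiteZ d} {κ : Fin d} (hp : ∀ i : Fin d, pairLo L q i ≤ p i ∧ p i ≤ pairHi L q μ i)
    (hp' : ∀ i : Fin d, pairLo L q i ≤ (p + e κ) i ∧ (p + e κ) i ≤ pairHi L q μ i) :
    ‖((gaugeAct ŵ V₀ p κ : 𝔸ˣ) : 𝔸) - 1‖ ≤ 4 * ((d : ℝ) + 1) ^ 2 * L ^ 2 * α₀ := by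
  have hl1p : (l1 (p - q) : ℝ) ≤ 2 * d * L := l1_le_of_mem_pairBox hLs hd hp
  have hdr : (0 : ℝ) ≤ d := Nat.cast_nonneg d
  have hLr : (1 : ℝ) ≤ L := by exact_mod_cast (show 1 ≤ L by omega)
  have hbig : (2 * d * L + L) * α₀ ≤ 4 * ((d : ℝ) + 1) ^ 2 * L ^ 2 * α₀ := by
    apply mul_le_mul_of_nonneg_right _ hα₀
    nlinarith
  by_cases h1 : p μ ≤ q μ + s
  · by_cases h2 : (p + e κ) μ ≤ q μ + s
    · have : gaugeAct ŵ V₀ p κ = gaugeAct (axialFn V₀ q) V₀ p κ := by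
        simp only [gaugeAct, hŵ, if_pos h1, if_pos h2]
      rw [this]
      calc _ ≤ (l1 (p - q)) * α₀ := axial_bond_bound V₀ hV q h44 hα₀ p κ
        _ ≤ (2 * d * L + L) * α₀ := by apply mul_le_mul_of_nonneg_right _ hα₀; linarith
        _ ≤ _ := hbig
    · have hκ : κ = μ := by
        by_contra hne
        apply h2
        have : (p + e κ) μ = p μ := by simp [e_apply, Ne.symm hne]
        rw [this]; exact h1
      subst hκ
      have hpμ : p κ = q κ + s := by
        have : (p + e κ) κ = p κ + 1 := by simp [e_apply]
        rw [this] at h2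
        omega
      have hG : gaugeAct ŵ V₀ p κ = axialFn V₀ q p * V₀ p κ *
          (hol V₀ q (seg κ L) * axialFn V₀ (q + (L : ℤ) • e κ) (p + e κ))⁻¹ := by
        simp only [gaugeAct, hŵ, if_pos h1, if_neg h2]
      rw [hG]
      obtain ⟨hA, hB⟩ := l1_crossing hLs hp hpμ
      exact crossing_boundZ hV hα₀ h44 q κ p hA hB
  · have h2 : ¬ (p + e κ) μ ≤ q μ + s := by
      intro h
      apply h1
      have : p μ ≤ (p + e κ) μ := by
        simp only [Pi.add_apply, e_apply]; split_ifs <;> omega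
      omega
    have : gaugeAct ŵ V₀ p κ =
        Rc (hol V₀ q (seg μ L)) (gaugeAct (axialFn V₀ (q + (L : ℤ) • e μ)) V₀ p κ) := by
      simp only [gaugeAct, hŵ, if_neg h1, if_neg h2, Rc_apply]; group
    rw [this]
    have hl1' : (l1 (p - (q + (L : ℤ) • e μ)) : ℝ) ≤ 2 * d * L + L := by
      have h3 : p - (q + (L : ℤ) • e μ) = (p - q) + -((L : ℤ) • e μ) := by abel
      have h4 := l1_add_le (p - q) (-((L : ℤ) • e μ))
      rw [l1_neg, l1_zsmul_e, Int.natAbs_natCast] at h4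
      rw [h3]
      calc (l1 ((p - q) + -((L : ℤ) • e μ)) : ℝ) ≤ (l1 (p - q) + L : ℕ) := by exact_mod_cast h4
        _ = l1 (p - q) + L := by push_cast; ring
        _ ≤ _ := by linarith
    calc _ ≤ ‖((gaugeAct (axialFn V₀ (q + (L : ℤ) • e μ)) V₀ p κ : 𝔸ˣ) : 𝔸) - 1‖ :=
          norm_Rc_sub_one_le (hol_mem hV _ _) _
      _ ≤ (l1 (p - (q + (L : ℤ) • e μ))) * α₀ := axial_bond_bound V₀ hV _ h44 hα₀ p κ
      _ ≤ (2 * d * L + L) * α₀ := mul_le_mul_of_nonneg_right hl1' hα₀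
      _ ≤ _ := hbig

end Crossing


end Literature.MathematicalPhysics.QuantumFieldTheory.Balaban1983to89.B7Prop9GeneralRec
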